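import Summits.HubbardSuperconductivity.HubbardSuperconductivity.Theorems.BalabanIRBirGroundStateAverageLROWeylPattern
import Literature.MathematicalPhysics.QuantumLattice.SectorGroundProjContinuity

/-!
# Route BalabanIR — target `BirGroundStateAverageLRO`: the exceptional couplings of the sector ground multiplicity are countable

Helper file `--supports stmt-HubbardSuperconductivity-2079` (THESES-FREE). Companion of
`Literature.MathematicalPhysics.QuantumLattice.SectorGroundProjContinuity`: there, for an affine
Hermitian pencil `H(u) = H₀ + u D` with an invariant sector `S`, the sector ground projection is
continuous off the CLOSED NOWHERE DENSE set of couplings at which the sector ground multiplicity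
`d_S(u) = dim (S ⊓ ker (H(u) - e_S(u)))` is not locally constant. Here that set is shown to be
COUNTABLE (`exists_countable_eventually_finrank_eq_of_pencil`): penalising the complement of the
sector with a strength `μ > e_S - e_⊤` turns the SECTOR ground multiplet of `H` into the FULL-SPACE
ground multiplet of `H + μ (1 - Π_S)` (`penalised_groundMultiplet_eq`, again an affine pencil in
`u`, with a locally uniform integer strength `exists_nat_penalisation_bound`), whose lowest
multiplicity is locally constant at every coupling of maximal distinct-eigenvalue count
(`eventually_finrank_groundMultiplet_top_eq` of
`Theorems/BalabanIRBirGroundStateAverageLROWeylPattern.lean`), i.e. off a finite set; the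
exceptional set is the union over `m ∈ ℕ` of these finite sets. This upgrades the window
uniformisation of the target's pointwise floor to "off a COUNTABLE set of couplings"
(`Theorems/BalabanIRBirGroundStateAverageLROWindowUniformisation.lean`). Kato (1966) II-§6.1.
All statements are folklore linear algebra; no definition is introduced.
-/

noncomputable section

namespace Summit.HubbardSuperconductivity.HubbardSuperconductivity.Theorems

open Matrix Filter Topology
open Literature.MathematicalPhysics.QuantumLattice Literature.Computability.AlgebraicComplexity
open Literature.MathematicalPhysics.QuantumLattice.EigenvalueContinuation

section Penalisation

variable {ι : Type*} [Fintype ι] [DecidableEq ι]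

omit [DecidableEq ι] in
/-- `⟨M v, N w⟩ = ⟨v, (Mᴴ N) w⟩`. [folklore] -/
theorem star_mulVec_dotProduct_mulVec (M N : Matrix ι ι ℂ) (v w : ι → ℂ) :
    star (M *ᵥ v) ⬝ᵥ N *ᵥ w = star v ⬝ᵥ (Mᴴ * N) *ᵥ w := by
  rw [star_mulVec, ← dotProduct_mulVec, mulVec_mulVec]

/-- **Penalising the complement of an invariant sector.** For Hermitian `H`, an `H`-invariant
sector `S ≠ ⊥` with projection `Q`, and `μ` with `e_S < e_⊤ + μ` (`e_S = minEnergyOn H S`,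
`e_⊤ = minEnergyOn H ⊤`), the penalised matrix `T = H + μ (1 - Q)` has full-space ground energy
`e_S`, and its full-space ground multiplet IS the sector ground multiplet of `H`:
`⊤ ⊓ ker (T - e_S) = S ⊓ ker (H - e_S)`. [folklore] -/
theorem penalised_groundMultiplet_eq [Nonempty ι] {H : Matrix ι ι ℂ} (hH : H.IsHermitian)
    (S : Submodule ℂ (ι → ℂ)) (hSH : ∀ v ∈ S, H *ᵥ v ∈ S) (hS : S ≠ ⊥) {μ : ℝ}
    (hμ : H.minEnergyOn S < H.minEnergyOn ⊤ + μ) {Q T : Matrix ι ι ℂ}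
    (hQ : Q = projMatrix (S.map
      ((WithLp.linearEquiv 2 ℂ (ι → ℂ)).symm : (ι → ℂ) →ₗ[ℂ] EuclideanSpace ℂ ι)))
    (hT : T = H + (μ : ℂ) • (1 - Q)) :
    T.minEnergyOn ⊤ = H.minEnergyOn S ∧
      ((⊤ : Submodule ℂ (ι → ℂ)) ⊓ Module.End.eigenspace (Matrix.toLin' T)
          ((T.minEnergyOn ⊤ : ℝ) : ℂ)) =
        S ⊓ Module.End.eigenspace (Matrix.toLin' H) ((H.minEnergyOn S : ℝ) : ℂ) := by
  classical
  have hQh : Q.IsHermitian := by rw [hQ]; exact projMatrix_isHermitian _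
  have hQQ : Q * Q = Q := by rw [hQ]; exact projMatrix_mul_self _
  have hQS : ∀ v, Q *ᵥ v ∈ S := fun v => by rw [hQ]; exact projMatrix_map_mulVec_mem S v
  have hQfix : ∀ v ∈ S, Q *ᵥ v = v := fun v hv => by
    rw [hQ]; exact projMatrix_map_mulVec_of_mem S hv
  have hcomm : Q * H = H * Q := by rw [hQ]; exact projMatrix_map_commute_of_invariant hH S hSH
  obtain ⟨h1h, h1P⟩ := one_sub_proj hQh hQQ
  have hTh : T.IsHermitian := by
    rw [hT]
    refine hH.add ?_
    rw [IsHermitian, conjTranspose_smul, h1h.eq, Complex.star_def, Complex.conj_ofReal]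
  set eS : ℝ := H.minEnergyOn S with heS
  set e0 : ℝ := H.minEnergyOn ⊤ with he0
  -- matrix identities from `Q H = H Q`
  have hHQ : H * Q = Qᴴ * H * Q := by
    rw [hQh.eq, hcomm, Matrix.mul_assoc, hQQ]
  have hH1 : H * (1 - Q) = (1 - Q)ᴴ * H * (1 - Q) := by
    rw [h1h.eq]
    have h0 : Q * H * (1 - Q) = 0 := by
      rw [hcomm, Matrix.mul_sub, Matrix.mul_one, Matrix.mul_assoc, hQQ, sub_self]
    rw [Matrix.sub_mul, Matrix.one_mul, Matrix.sub_mul, h0, sub_zero]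
  have hTv : ∀ v, T *ᵥ v = H *ᵥ v + (μ : ℂ) • ((1 - Q) *ᵥ v) := fun v => by
    rw [hT, add_mulVec, smul_mulVec]
  have hdecomp : ∀ v : ι → ℂ, Q *ᵥ v + (1 - Q) *ᵥ v = v := fun v => by
    rw [sub_mulVec, one_mulVec, add_sub_cancel]
  -- quadratic forms split along `v = Q v + (1 - Q) v`
  have hqH : ∀ v, star v ⬝ᵥ H *ᵥ v =
      star (Q *ᵥ v) ⬝ᵥ H *ᵥ (Q *ᵥ v) + star ((1 - Q) *ᵥ v) ⬝ᵥ H *ᵥ ((1 - Q) *ᵥ v) := by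
    intro v
    rw [star_mulVec_dotProduct_mulVec, star_mulVec_dotProduct_mulVec, mulVec_mulVec,
      mulVec_mulVec, ← hHQ, ← hH1, ← mulVec_mulVec, ← mulVec_mulVec, ← dotProduct_add,
      ← mulVec_add, hdecomp]
  have hq1 : ∀ v, star v ⬝ᵥ (1 - Q) *ᵥ v = star ((1 - Q) *ᵥ v) ⬝ᵥ ((1 - Q) *ᵥ v) :=
    fun v => star_dotProduct_mulVec_eq_of_proj h1h h1P v
  have hqQ : ∀ v, star v ⬝ᵥ Q *ᵥ v = star (Q *ᵥ v) ⬝ᵥ (Q *ᵥ v) :=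
    fun v => star_dotProduct_mulVec_eq_of_proj hQh hQQ v
  have hnorm : ∀ v, (star v ⬝ᵥ v).re =
      (star (Q *ᵥ v) ⬝ᵥ (Q *ᵥ v)).re + (star ((1 - Q) *ᵥ v) ⬝ᵥ ((1 - Q) *ᵥ v)).re := by
    intro v
    rw [← Complex.add_re, ← hqQ, ← hq1, ← dotProduct_add, hdecomp]
  -- the chain of inequalities
  have hchain : ∀ v, eS * (star (Q *ᵥ v) ⬝ᵥ (Q *ᵥ v)).re +
      (e0 + μ) * (star ((1 - Q) *ᵥ v) ⬝ᵥ ((1 - Q) *ᵥ v)).re ≤ (star v ⬝ᵥ T *ᵥ v).re := by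
    intro v
    have hT' : (star v ⬝ᵥ T *ᵥ v).re = (star (Q *ᵥ v) ⬝ᵥ H *ᵥ (Q *ᵥ v)).re +
        (star ((1 - Q) *ᵥ v) ⬝ᵥ H *ᵥ ((1 - Q) *ᵥ v)).re +
        μ * (star ((1 - Q) *ᵥ v) ⬝ᵥ ((1 - Q) *ᵥ v)).re := by
      rw [hTv, dotProduct_add, dotProduct_smul, hqH, hq1, Complex.add_re, Complex.add_re,
        smul_eq_mul, Complex.re_ofReal_mul]
    have ha := minEnergyOn_mul_le_re_rayleigh hH S (hQS v)
    have hb := minEnergyOn_mul_le_re_rayleigh hH ⊤ (Submodule.mem_top : (1 - Q) *ᵥ v ∈ ⊤)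
    rw [hT']
    linarith
  have hge : ∀ v, eS * (star v ⬝ᵥ v).re ≤ (star v ⬝ᵥ T *ᵥ v).re := fun v => by
    have h1 := hchain v
    have hb0 := re_star_dotProduct_self_nonneg ((1 - Q) *ᵥ v)
    rw [hnorm v]
    nlinarith
  -- a sector ground state of `H` is a full-space ground state of `T`
  obtain ⟨ψ, hψS, hψ1, hHψ⟩ := exists_unit_eigen_minEnergyOn hH S hSH hS
  have hTψ : T *ᵥ ψ = (eS : ℂ) • ψ := by
    rw [hTv, hHψ, sub_mulVec, one_mulVec, hQfix ψ hψS, sub_self, smul_zero, add_zero]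
  have hTmin : T.minEnergyOn ⊤ = eS := by
    apply le_antisymm
    · have := minEnergyOn_le_rayleigh_of_mem hTh ⊤ (Submodule.mem_top : ψ ∈ ⊤) hψ1
      rwa [re_star_dotProduct_mulVec_of_eigen hTψ, hψ1, Complex.one_re, mul_one] at this
    · rw [Matrix.minEnergyOn]
      refine le_csInf ⟨_, ψ, Submodule.mem_top, hψ1, rfl⟩ ?_
      rintro _ ⟨φ, -, hφ1, rfl⟩
      have := hge φ
      rwa [hφ1, Complex.one_re, mul_one] at this
  refine ⟨hTmin, le_antisymm ?_ ?_⟩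
  · intro v hv
    rw [hTmin] at hv
    obtain ⟨-, hTv'⟩ := (mem_inf_eigenspace_toLin'_iff T ⊤ eS v).1 hv
    have hEq : (star v ⬝ᵥ T *ᵥ v).re = eS * (star v ⬝ᵥ v).re :=
      re_star_dotProduct_mulVec_of_eigen hTv'
    have h1 := hchain v
    have hb0 := re_star_dotProduct_self_nonneg ((1 - Q) *ᵥ v)
    rw [hEq, hnorm v] at h1
    have hbzero : (star ((1 - Q) *ᵥ v) ⬝ᵥ ((1 - Q) *ᵥ v)).re ≤ 0 := by nlinarith
    have hb : (1 - Q) *ᵥ v = 0 := by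
      by_contra hne
      have := re_star_dotProduct_self_pos hne
      linarith
    have hvS : v ∈ S := by
      rw [← hdecomp v, hb, add_zero]; exact hQS v
    refine (mem_inf_eigenspace_toLin'_iff H S eS v).2 ⟨hvS, ?_⟩
    have := hTv v
    rw [hTv', hb, smul_zero, add_zero] at this
    exact this.symm
  · intro v hv
    obtain ⟨hvS, hHv⟩ := (mem_inf_eigenspace_toLin'_iff H S eS v).1 hv
    rw [hTmin]
    refine (mem_inf_eigenspace_toLin'_iff T ⊤ eS v).2 ⟨Submodule.mem_top, ?_⟩
    rw [hTv, hHv, sub_mulVec, one_mulVec, hQfix v hvS, sub_self, smul_zero, add_zero]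

/-- **Local bound for the penalisation strength.** Along the pencil `H(u) = H₀ + u D` with
invariant sector `S ≠ ⊥`: for every `u₀` there is `m₀` with `e_S(u) < e_⊤(u) + m` for all
`m ≥ m₀` and `|u - u₀| < 1` (both sector energies are `Σ|Dᵢₖ|`-Lipschitz in `u`). [folklore] -/
theorem exists_nat_penalisation_bound [Nonempty ι] {H₀ D : Matrix ι ι ℂ} (hH₀ : H₀.IsHermitian)
    (hD : D.IsHermitian) (S : Submodule ℂ (ι → ℂ)) (hSH : ∀ v ∈ S, H₀ *ᵥ v ∈ S)
    (hSD : ∀ v ∈ S, D *ᵥ v ∈ S) (hS : S ≠ ⊥) (u₀ : ℝ) :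
    ∃ m₀ : ℕ, ∀ m : ℕ, m₀ ≤ m → ∀ u : ℝ, |u - u₀| < 1 →
      (H₀ + (u : ℂ) • D).minEnergyOn S < (H₀ + (u : ℂ) • D).minEnergyOn ⊤ + m := by
  classical
  set R : ℝ := ∑ i, ∑ k, ‖D i k‖ with hR
  have hR0 : 0 ≤ R := Finset.sum_nonneg fun i _ => Finset.sum_nonneg fun k _ => norm_nonneg _
  have hAh : ∀ u : ℝ, (H₀ + (u : ℂ) • D).IsHermitian := fun u => isHermitian_add_ofReal_smul hH₀ hD u
  have hAK : ∀ (K : Submodule ℂ (ι → ℂ)), (∀ v ∈ K, H₀ *ᵥ v ∈ K) → (∀ v ∈ K, D *ᵥ v ∈ K) →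
      ∀ u : ℝ, ∀ v ∈ K, (H₀ + (u : ℂ) • D) *ᵥ v ∈ K := fun K hKH hKD u v hv => by
    rw [add_mulVec, smul_mulVec]
    exact K.add_mem (hKH v hv) (K.smul_mem _ (hKD v hv))
  -- supergradient bounds: `e_K(t) ≤ e_K(s) + |t - s| R` for `K = S, ⊤`
  have hsuper : ∀ (K : Submodule ℂ (ι → ℂ)), (∀ v ∈ K, H₀ *ᵥ v ∈ K) → (∀ v ∈ K, D *ᵥ v ∈ K) →
      K ≠ ⊥ → ∀ s t : ℝ, (H₀ + (t : ℂ) • D).minEnergyOn K ≤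
        (H₀ + (s : ℂ) • D).minEnergyOn K + |t - s| * R := by
    intro K hKH hKD hK s t
    obtain ⟨ψ, hψK, hψ1, hψ⟩ := exists_unit_eigen_minEnergyOn (hAh s) K (hAK K hKH hKD s) hK
    have h := minEnergyOn_pencil_le_of_ground hH₀ hD K hψK hψ1
      (re_rayleigh_of_eigen_minEnergyOn _ K hψ1 hψ) t
    have hy := abs_re_rayleigh_le_sum_norm D hψ1
    have : (t - s) * (star ψ ⬝ᵥ D *ᵥ ψ).re ≤ |t - s| * R := by
      calc (t - s) * (star ψ ⬝ᵥ D *ᵥ ψ).re ≤ |(t - s) * (star ψ ⬝ᵥ D *ᵥ ψ).re| := le_abs_self _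
        _ = |t - s| * |(star ψ ⬝ᵥ D *ᵥ ψ).re| := abs_mul _ _
        _ ≤ |t - s| * R := mul_le_mul_of_nonneg_left hy (abs_nonneg _)
    linarith
  have htop : (⊤ : Submodule ℂ (ι → ℂ)) ≠ ⊥ := by
    intro h
    obtain ⟨v, hv, hv0⟩ := Submodule.exists_mem_ne_zero_of_ne_bot hS
    exact hv0 ((Submodule.eq_bot_iff _).1 h v Submodule.mem_top)
  set x : ℝ := (H₀ + (u₀ : ℂ) • D).minEnergyOn S - (H₀ + (u₀ : ℂ) • D).minEnergyOn ⊤ + 2 * R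
    with hx
  refine ⟨⌈x⌉₊ + 1, fun m hm u hu => ?_⟩
  have h1 := hsuper S hSH hSD hS u₀ u
  have h2 := hsuper ⊤ (fun _ _ => Submodule.mem_top) (fun _ _ => Submodule.mem_top) htop u u₀
  rw [abs_sub_comm] at h2
  have hmx : x < m := by
    have h3 : (⌈x⌉₊ : ℝ) + 1 ≤ m := by exact_mod_cast hm
    have h4 := Nat.le_ceil x
    linarith
  nlinarith [abs_nonneg (u - u₀)]

/-- **The exceptional couplings of the sector ground multiplicity are countable** (the pencil
`A`, and its sector ground multiplet `E`, given by defining equations). Along an affine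
Hermitian pencil `A(u) = H₀ + u D` with a sector `S ≠ ⊥` invariant under both, there is a
COUNTABLE set `X ⊆ ℝ` off which the sector ground multiplicity
`dim E(u) = dim (S ⊓ ker (A(u) - e_S(u)))` is locally constant (penalise the complement of `S` with a
large integer strength `m`, so that the sector ground multiplet becomes the full-space ground
multiplet of the pencil `H₀ + m(1 - Q) + u D`, whose lowest multiplicity is locally constant at
every coupling of maximal distinct-eigenvalue count, i.e. off a finite set
`exists_finset_forall_card_roots_le`; `X` is the union over `m` of these finite sets).
Kato (1966) II-§6.1 (finitely many exceptional points); here countably many. [folklore] -/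
theorem exists_countable_eventually_finrank_eq_of_pencil [Nonempty ι] {H₀ D : Matrix ι ι ℂ}
    (hH₀ : H₀.IsHermitian) (hD : D.IsHermitian) (S : Submodule ℂ (ι → ℂ))
    (hSH : ∀ v ∈ S, H₀ *ᵥ v ∈ S) (hSD : ∀ v ∈ S, D *ᵥ v ∈ S) (hS : S ≠ ⊥)
    {A : ℝ → Matrix ι ι ℂ} {E : ℝ → Submodule ℂ (ι → ℂ)} (hA : ∀ u, A u = H₀ + (u : ℂ) • D)
    (hE : ∀ u, E u = S ⊓ Module.End.eigenspace (Matrix.toLin' (A u))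
      (((A u).minEnergyOn S : ℝ) : ℂ)) :
    ∃ X : Set ℝ, X.Countable ∧ ∀ u₀ : ℝ, u₀ ∉ X → ∀ᶠ u : ℝ in 𝓝 u₀,
      Module.finrank ℂ (E u) = Module.finrank ℂ (E u₀) := by
  classical
  set Q : Matrix ι ι ℂ := projMatrix (S.map
    ((WithLp.linearEquiv 2 ℂ (ι → ℂ)).symm : (ι → ℂ) →ₗ[ℂ] EuclideanSpace ℂ ι)) with hQ
  have hQh : Q.IsHermitian := projMatrix_isHermitian _
  have hQQ : Q * Q = Q := projMatrix_mul_self _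
  obtain ⟨h1h, -⟩ := one_sub_proj hQh hQQ
  -- the penalised pencils `M m + u D`, `M m = H₀ + m (1 - Q)`
  set M : ℕ → Matrix ι ι ℂ := fun m => H₀ + ((m : ℝ) : ℂ) • (1 - Q) with hM
  have hMh : ∀ m, (M m).IsHermitian := fun m => by
    refine hH₀.add ?_
    rw [IsHermitian, conjTranspose_smul, h1h.eq, Complex.star_def, Complex.conj_ofReal]
  have hfin : ∀ m : ℕ, ∃ T : Finset ℝ, ∀ u : ℝ, u ∉ T → ∀ u' : ℝ,
      (M m + ((u' : ℝ) : ℂ) • D).charpoly.roots.toFinset.card ≤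
        (M m + (u : ℂ) • D).charpoly.roots.toFinset.card := fun m =>
    exists_finset_forall_card_roots_le
      (hMh m) hD
  choose T hT using hfin
  refine ⟨⋃ m, (T m : Set ℝ), Set.countable_iUnion fun m => (T m).countable_toSet, fun u₀ hu₀ => ?_⟩
  have hAh : ∀ u : ℝ, (H₀ + (u : ℂ) • D).IsHermitian := fun u => isHermitian_add_ofReal_smul hH₀ hD u
  have hSA : ∀ u : ℝ, ∀ v ∈ S, (H₀ + (u : ℂ) • D) *ᵥ v ∈ S := fun u v hv => by
    rw [add_mulVec, smul_mulVec]
    exact S.add_mem (hSH v hv) (S.smul_mem _ (hSD v hv))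
  obtain ⟨m₀, hm₀⟩ := exists_nat_penalisation_bound hH₀ hD S hSH hSD hS u₀
  have hu₀T : u₀ ∉ T m₀ := fun h => hu₀ (Set.mem_iUnion.2 ⟨m₀, h⟩)
  -- the penalised ground multiplet is the sector ground multiplet, for `|u - u₀| < 1`
  have hpen : ∀ u : ℝ, |u - u₀| < 1 →
      ((⊤ : Submodule ℂ (ι → ℂ)) ⊓ Module.End.eigenspace (Matrix.toLin' (M m₀ + (u : ℂ) • D))
          (((M m₀ + (u : ℂ) • D).minEnergyOn ⊤ : ℝ) : ℂ)) =
        S ⊓ Module.End.eigenspace (Matrix.toLin' (H₀ + (u : ℂ) • D))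
          (((H₀ + (u : ℂ) • D).minEnergyOn S : ℝ) : ℂ) := fun u hu =>
    (penalised_groundMultiplet_eq (hAh u) S (hSA u) hS (hm₀ m₀ le_rfl u hu) hQ
      (by rw [hM]; dsimp only; abel)).2
  have hloc := eventually_finrank_groundMultiplet_top_eq (hMh m₀) hD (hT m₀ u₀ hu₀T)
  have hnear : ∀ᶠ u : ℝ in 𝓝 u₀, |u - u₀| < 1 := by
    rw [Metric.eventually_nhds_iff]
    exact ⟨1, one_pos, fun u hu => by rwa [Real.dist_eq] at hu⟩
  have hEu : ∀ u : ℝ, E u = S ⊓ Module.End.eigenspace (Matrix.toLin' (H₀ + (u : ℂ) • D))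
      (((H₀ + (u : ℂ) • D).minEnergyOn S : ℝ) : ℂ) := fun u => by rw [hE, hA]
  filter_upwards [hloc, hnear] with u hu1 hu2
  rw [LinearEquiv.finrank_eq (LinearEquiv.ofEq _ _ ((hEu u).trans (hpen u hu2).symm)),
    LinearEquiv.finrank_eq (LinearEquiv.ofEq _ _ ((hEu u₀).trans (hpen u₀ (by simp)).symm)), hu1]

/-- **The exceptional couplings of the sector ground multiplicity are countable** (explicit
form of `exists_countable_eventually_finrank_eq_of_pencil`). [folklore] -/
theorem exists_countable_eventually_finrank_groundMultiplet_eq [Nonempty ι] {H₀ D : Matrix ι ι ℂ}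
    (hH₀ : H₀.IsHermitian) (hD : D.IsHermitian) (S : Submodule ℂ (ι → ℂ))
    (hSH : ∀ v ∈ S, H₀ *ᵥ v ∈ S) (hSD : ∀ v ∈ S, D *ᵥ v ∈ S) (hS : S ≠ ⊥) :
    ∃ X : Set ℝ, X.Countable ∧ ∀ u₀ : ℝ, u₀ ∉ X → ∀ᶠ u : ℝ in 𝓝 u₀,
      Module.finrank ℂ ↥(S ⊓ Module.End.eigenspace (Matrix.toLin' (H₀ + (u : ℂ) • D))
          (((H₀ + (u : ℂ) • D).minEnergyOn S : ℝ) : ℂ)) =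
        Module.finrank ℂ ↥(S ⊓ Module.End.eigenspace (Matrix.toLin' (H₀ + (u₀ : ℂ) • D))
          (((H₀ + (u₀ : ℂ) • D).minEnergyOn S : ℝ) : ℂ)) :=
  exists_countable_eventually_finrank_eq_of_pencil hH₀ hD S hSH hSD hS
    (A := fun u => H₀ + (u : ℂ) • D)
    (E := fun u => S ⊓ Module.End.eigenspace (Matrix.toLin' (H₀ + (u : ℂ) • D))
      (((H₀ + (u : ℂ) • D).minEnergyOn S : ℝ) : ℂ))
    (fun _ => rfl) (fun _ => rfl)


end Penalisation

end Summit.HubbardSuperconductivity.HubbardSuperconductivity.Theorems
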